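import Summits.CriticalPhenomena.PercolationContinuityZ3.Theorems.PercNearOneGluingNoHeavyQuantReducibleSibling
import Summits.CriticalPhenomena.PercolationContinuityZ3.Theorems.PercNearOneGluingNoHeavyQuantSiblingStepResidualGroup
import Summits.CriticalPhenomena.PercolationContinuityZ3.Theorems.PercNearOneGluingNoHeavyQuantRootPatternRegating
import Summits.CriticalPhenomena.PercolationContinuityZ3.Theorems.PercNearOneGluingNoHeavyQuantGluedPairMix
import HarnessLib

/-!
# QUANT lane R8, T-DEC: MEAN-LIGHT SIBLINGS ARE REDUCIBLE — every gated sibling law with mean `q·E[count] ≤ 1` lies in the blob hull at every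
# tree-OK floor; hence a forest ALL of whose siblings are mean-light is SDEC OUTRIGHT (any width, any sub-trees, no oracle), and ON THE NODE'S
# LIST BINDER one mean-light sibling makes the whole forest free: `SiblingStep` owes only forests of MEAN-HEAVY siblings (census-1 gen 28)

builds on p205010 (kernel theorem, internal audit signed; external expert review pending)

Support file (`--supports stmt-CriticalPhenomena-4575`), QUANT lane seat prim-quant-census-1 (gen 28); memo
`run/shared/lean/prim/quant/prim-quant-census-1/g28/FAN-G28.md` §8.  Theorems only, standard axioms, no sorries.  Over typer g40's blob hull
(`InBlobHull`, `inBlobHull_flaw_of_forall`, `sdec_of_inBlobHull`, `sdec_siblings_of_reducible`, `…QuantJointBlobHull` / `…ReducibleSibling` /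
`…SiblingStepResidualGroup`), lead g46's `blobLaw_single_apply` (`…GluedPairMix`) and `Sib.mean_pos` (`…RootPatternRegating`).

THE OBSERVATION (moment geometry).  The extreme points of the probability laws on `{0,…,K}` with mean `m ≤ 1` are the gated blobs
`gate_{m/j} δ_j = {0: 1 − m/j, j: m/j}`, `j = 1…K` (and `δ₀` for `m = 0`): explicitly, a law `σ` with mean `0 < m ≤ 1` is the mixture
`σ = Σ_{j=1}^{K} (j·σ(j)/m) · blobLaw [(j, m/j)]` — weights `j·σ(j)/m ≥ 0` summing to `Σ j σ(j)/m = 1`, the atom `0` by mass balance.  Every gate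
`m/j` lies in `[m/K, 1]`, so for a floor `x` with `x·K ≤ m` the law is a member of the blob hull `InBlobHull x m K` (`inBlobHull_of_mean_le_one`).
For a gated sibling `gate s.ρ s.q` (law-OK, mean `m = s.q·s.mean`) the floor condition `x·s.M ≤ s.q·s.mean` holds at EVERY tree-OK floor
(`x ≤ q·x₁`, `x₁·M ≤ mean ρ` by top-affordability of the tree-built sub-forest): **every MEAN-LIGHT sibling (`s.q·s.mean ≤ 1`) is hull-reducible at
every tree-OK floor** (`inBlobHull_gate_of_meanLight`, `inBlobHull_gate_of_meanLight_treeOK`).  Consequences: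
* **`sdec_flaw_of_meanLight`** / **`sdec_flaw_of_meanLight_treeOK`**: a sibling forest ALL of whose siblings are mean-light is `SDEC x (ftop L) (flaw L)` —
  every width, every sub-tree shape, NO oracle (`inBlobHull_flaw_of_forall` + `sdec_of_inBlobHull`).  E.g. every forest of 2-chains `R[qᵢ](R[pᵢ])` with
  `qᵢ(1+pᵢ) ≤ 1`, of stars `R[q](R[g₁] … R[g_n])` with `q(1 + Σgᵢ) ≤ 1`, of any trees whose root gate times expected relay count is `≤ 1`, in any mixture.
* **`sdec_siblings_of_meanLight`** (ON THE NODE'S LIST BINDER): if SOME sibling of a tree-OK list is mean-light, the oracle below `fgates L` gives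
  `SDEC x (ftop L) (flaw L)` (`sdec_siblings_of_reducible`) — so the sibling step (`SiblingStep` ⟺ `GateStepN`) owes only forests ALL of whose siblings
  are MEAN-HEAVY (`qᵢ·E[countᵢ] > 1`), in addition to typer g40's residue (≥ 3 relays each, jointly non-hull, uncovered outer gates).
RELATION TO EARLIER ROWS.  Lead g46's `inBlobHull_gluedPair_of_le` is the glued-pair instance (`R^a[q](R^b[s])` with `q(a + bs) ≤ a`, floors `x ≤ qs`);
census-1 g28's own `sdec_symForest_twoChain_light` (k identical 2-chains, `kq(1+p) ≤ 3 ⟹ q(1+p) ≤ 1`) is, at tree-OK floors, an instance of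
`sdec_flaw_of_meanLight_treeOK` (its torque certificate also covers the top-affordable floors `qp < x ≤ q(1+p)/2`, as does `inBlobHull_gate_of_meanLight`).
Arm-1 g54's `sdec_flaw_of_fmean_le_two` (TOTAL mean ≤ 2) and this file (EACH sibling mean ≤ 1, total unbounded) are incomparable.

* **`inBlobHull_of_mean_le_one`** (with lead g46's `blobLaw_single_apply`), **`inBlobHull_gate_of_meanLight`**, `inBlobHull_gate_of_meanLight_treeOK`;
* **`sdec_flaw_of_meanLight`**, **`sdec_flaw_of_meanLight_treeOK`**, **`sdec_siblings_of_meanLight`**.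

HONEST STATUS.  Structural reduction (k-free, oracle-free for all-light forests); `SiblingStep` ⟺ `GateStepN`, `UPartStep`, `LightResidDECOracle`, `FarTreeRow`
OPEN — the owed forests are the mean-heavy ones (this is where the near-sure corner of census-1 g28's censuses lives).  RATE class (log\*) / honest
sentence of `run/shared/lean/prim/quant/README.md` unchanged.  [this work].  That the extreme points of the laws on a finite set with prescribed mean
are two-point laws is classical moment geometry; nothing here is cited as a published result.  The gluing rows served
[cite: KozmaNitzan2024, Conjecture 3 (p. 15)]; product measure [cite: Grimmett1999, §1.3 p. 10].
-/

noncomputable section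

open scoped BigOperators

namespace Summit.CriticalPhenomena.PercolationContinuityZ3.Theorems
namespace Quant
namespace LawDec

open Finset

/-! ### Laws of mean at most one are mixtures of gated blobs -/

/-- **A LAW ON `{0..K}` WITH MEAN `0 < m ≤ 1` LIES IN THE BLOB HULL AT EVERY FLOOR `x` WITH `x·K ≤ m`** — as the mixture
`Σ_{j=1}^{K} (j·σ(j)/m)·blobLaw [(j, m/j)]` of gated blobs of mean `m` with gates `m/j ∈ [m/K, 1] ⊆ [x, 1]`. [this work] -/
theorem inBlobHull_of_mean_le_one (x m : ℝ) (K : ℕ) (σ : ℕ → ℝ) (hσ0 : ∀ h, 0 ≤ σ h) (hσK : ∀ h, K < h → σ h = 0)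
    (hσ1 : ∑ h ∈ Finset.range (K + 1), σ h = 1) (hmean : ∑ h ∈ Finset.range (K + 1), (h : ℝ) * σ h = m)
    (hm0 : 0 < m) (hm1 : m ≤ 1) (hx : x * (K : ℝ) ≤ m) : InBlobHull x m K σ := by
  classical
  -- the mean without the atom `0`, indexed by `Fin K` (blob sizes `j + 1`)
  have hmean' : ∑ j : Fin K, (((j : ℕ) + 1 : ℕ) : ℝ) * σ ((j : ℕ) + 1) = m := by
    rw [Fin.sum_univ_eq_sum_range (fun j => (((j + 1 : ℕ) : ℝ)) * σ (j + 1)) K, ← hmean, Finset.sum_range_succ']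
    simp
  have hmass' : ∑ j : Fin K, σ ((j : ℕ) + 1) = 1 - σ 0 := by
    rw [Fin.sum_univ_eq_sum_range (fun j => σ (j + 1)) K]
    have := Finset.sum_range_succ' σ K
    rw [hσ1] at this
    linarith
  refine ⟨Fin K, inferInstance, fun j => (((j : ℕ) + 1 : ℕ) : ℝ) * σ ((j : ℕ) + 1) / m, fun j => [((j : ℕ) + 1, m / (((j : ℕ) + 1 : ℕ) : ℝ))],
    fun j => div_nonneg (mul_nonneg (Nat.cast_nonneg _) (hσ0 _)) hm0.le, ?_, fun j p hp => ?_, fun j => ?_, fun j => ?_, fun h => ?_⟩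
  · -- weights sum to one
    rw [← Finset.sum_div, hmean', div_self hm0.ne']
  · -- gates in `[x, 1]`
    rw [List.mem_singleton] at hp
    subst hp
    have hj1 : (1 : ℝ) ≤ (((j : ℕ) + 1 : ℕ) : ℝ) := by exact_mod_cast Nat.succ_le_succ (Nat.zero_le _)
    have hjK : (((j : ℕ) + 1 : ℕ) : ℝ) ≤ K := by exact_mod_cast j.2
    have hjpos : (0 : ℝ) < (((j : ℕ) + 1 : ℕ) : ℝ) := by linarith
    refine ⟨?_, ?_⟩
    · show x ≤ m / (((j : ℕ) + 1 : ℕ) : ℝ)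
      rw [le_div_iff₀ hjpos]
      rcases le_or_gt x 0 with hx0 | hx0
      · nlinarith
      · nlinarith
    · show m / (((j : ℕ) + 1 : ℕ) : ℝ) ≤ 1
      rw [div_le_one hjpos]; linarith
  · -- tops
    show blobTop [((j : ℕ) + 1, m / (((j : ℕ) + 1 : ℕ) : ℝ))] ≤ K
    simp only [blobTop, zero_add]
    exact j.2
  · -- means
    show blobMean [((j : ℕ) + 1, m / (((j : ℕ) + 1 : ℕ) : ℝ))] = m
    simp only [blobMean, zero_add]
    have hjpos : (0 : ℝ) < (((j : ℕ) + 1 : ℕ) : ℝ) := by positivity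
    field_simp
  · -- the mixture identity, atom by atom
    simp only [blobLaw_single_apply]
    by_cases h0 : h = 0
    · subst h0
      have e : ∀ j : Fin K, (((j : ℕ) + 1 : ℕ) : ℝ) * σ ((j : ℕ) + 1) / m *
          ((if (0 : ℕ) = 0 then 1 - m / (((j : ℕ) + 1 : ℕ) : ℝ) else 0) + (if (0 : ℕ) = (j : ℕ) + 1 then m / (((j : ℕ) + 1 : ℕ) : ℝ) else 0))
          = (((j : ℕ) + 1 : ℕ) : ℝ) * σ ((j : ℕ) + 1) / m - σ ((j : ℕ) + 1) := by
        intro j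
        rw [if_pos rfl, if_neg (by omega)]
        have hjpos : (0 : ℝ) < (((j : ℕ) + 1 : ℕ) : ℝ) := by positivity
        field_simp
        ring
      rw [Finset.sum_congr rfl fun j _ => e j, Finset.sum_sub_distrib, ← Finset.sum_div, hmean', div_self hm0.ne', hmass']
      ring
    · by_cases hK : h ≤ K
      · -- `1 ≤ h ≤ K`: the single blob of size `h`
        obtain ⟨i, rfl⟩ : ∃ i, h = i + 1 := ⟨h - 1, by omega⟩
        have hiK : i < K := by omega
        rw [Finset.sum_eq_single ⟨i, hiK⟩]
        · rw [if_neg h0, if_pos (by simp), zero_add]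
          have hjpos : (0 : ℝ) < (((i : ℕ) + 1 : ℕ) : ℝ) := by positivity
          show σ (i + 1) = (((i : ℕ) + 1 : ℕ) : ℝ) * σ (i + 1) / m * (m / (((i : ℕ) + 1 : ℕ) : ℝ))
          field_simp
        · intro j _ hj
          have hne : ¬ (i + 1 = (j : ℕ) + 1) := by
            intro e
            apply hj
            apply Fin.ext
            show (j : ℕ) = i
            omega
          rw [if_neg h0, if_neg hne]; ring
        · intro hni; exact absurd (Finset.mem_univ _) hni
      · -- above the top
        rw [hσK h (not_le.1 hK)]
        symm
        refine Finset.sum_eq_zero fun j _ => ?_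
        have hne : ¬ (h = (j : ℕ) + 1) := by have := j.2; omega
        rw [if_neg h0, if_neg hne]; ring

/-! ### Mean-light siblings are hull members -/

/-- **A MEAN-LIGHT GATED SIBLING IS A HULL MEMBER**: law-OK `s` with `0 < s.mean`, `s.q·s.mean ≤ 1` and a floor with `x·s.M ≤ s.q·s.mean` ⟹
`InBlobHull x (s.q·s.mean) s.M (gate s.ρ s.q)`. [this work] -/
theorem inBlobHull_gate_of_meanLight {x : ℝ} (s : Sib) (hs : s.LawOK) (hmean0 : 0 < s.mean) (hlight : s.q * s.mean ≤ 1)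
    (hfl : x * (s.M : ℝ) ≤ s.q * s.mean) : InBlobHull x (s.q * s.mean) s.M (gate s.ρ s.q) := by
  obtain ⟨hq0, hq1, ρ0, ρM, ρ1⟩ := hs
  obtain ⟨g0, gM, g1⟩ := gate_laws s.M s.ρ s.q hq0.le hq1.le ρ0 ρM ρ1
  have gmean : ∑ h ∈ Finset.range (s.M + 1), (h : ℝ) * gate s.ρ s.q h = s.q * s.mean := by
    rw [sum_mul_gate]; rfl
  exact inBlobHull_of_mean_le_one x (s.q * s.mean) s.M (gate s.ρ s.q) g0 gM g1 gmean (mul_pos hq0 hmean0) hlight hfl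

/-- **… AT EVERY TREE-OK FLOOR**: for a tree-OK sibling the floor condition is automatic (`x ≤ q·x₁`, `x₁·M ≤ mean ρ`). [this work] -/
theorem inBlobHull_gate_of_meanLight_treeOK {x : ℝ} (s : Sib) (hs : s.TreeOK x) (hlight : s.q * s.mean ≤ 1) :
    InBlobHull x (s.q * s.mean) s.M (gate s.ρ s.q) := by
  have hmean0 : 0 < s.mean := Sib.mean_pos s hs
  have hOK := hs.lawOK
  obtain ⟨hq0, _, hxq, hT, _⟩ := hs
  obtain ⟨_, _, _, _, _, hta⟩ := hT.lawFacts
  refine inBlobHull_gate_of_meanLight s hOK hmean0 hlight ?_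
  have h1 : x * (s.M : ℝ) ≤ s.q * s.x₁ * (s.M : ℝ) := mul_le_mul_of_nonneg_right hxq (Nat.cast_nonneg _)
  have h2 : s.q * (s.x₁ * (s.M : ℝ)) ≤ s.q * s.mean := mul_le_mul_of_nonneg_left hta hq0.le
  linarith

/-! ### Forests of mean-light siblings are SDEC outright; one mean-light sibling frees the node -/

/-- **EVERY FOREST OF MEAN-LIGHT SIBLINGS IS SDEC — any width, any sub-trees, NO oracle.**  Law-OK siblings with positive sub-forest means,
`sᵢ.q·sᵢ.mean ≤ 1` and `x·sᵢ.M ≤ sᵢ.q·sᵢ.mean` for every member, `0 < x < 1` ⟹ `SDEC x (ftop L) (flaw L)`. [this work] -/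
theorem sdec_flaw_of_meanLight {x : ℝ} (hx0 : 0 < x) (hx1 : x < 1) (L : List Sib) (hL : ∀ s ∈ L, s.LawOK)
    (hmean0 : ∀ s ∈ L, 0 < s.mean) (hlight : ∀ s ∈ L, s.q * s.mean ≤ 1) (hfl : ∀ s ∈ L, x * (s.M : ℝ) ≤ s.q * s.mean) :
    SDEC x (ftop L) (flaw L) :=
  sdec_of_inBlobHull hx0 hx1
    (inBlobHull_flaw_of_forall L fun s hs => inBlobHull_gate_of_meanLight s (hL s hs) (hmean0 s hs) (hlight s hs) (hfl s hs))

/-- **THE TREE-OK FORM**: a tree-OK sibling list ALL of whose members are mean-light (`sᵢ.q·sᵢ.mean ≤ 1`) is SDEC at its floor — any width,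
any sub-tree shapes, no oracle. [this work] -/
theorem sdec_flaw_of_meanLight_treeOK {x : ℝ} (hx0 : 0 < x) (L : List Sib) (hL : ∀ s ∈ L, s.TreeOK x) (hne : L ≠ [])
    (hlight : ∀ s ∈ L, s.q * s.mean ≤ 1) : SDEC x (ftop L) (flaw L) := by
  obtain ⟨s, hs⟩ := List.exists_mem_of_ne_nil L hne
  obtain ⟨_, hq1, hxq, hT, _⟩ := hL s hs
  obtain ⟨_, hx₁1, _, _, _, _⟩ := hT.lawFacts
  have hx1 : x < 1 := by nlinarith
  exact sdec_of_inBlobHull hx0 hx1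
    (inBlobHull_flaw_of_forall L fun t ht => inBlobHull_gate_of_meanLight_treeOK t (hL t ht) (hlight t ht))

/-- **ON THE NODE'S LIST BINDER, ONE MEAN-LIGHT SIBLING FREES THE FOREST**: for a tree-OK list with the oracle below `fgates L`, if some member
has `s.q·s.mean ≤ 1` then `SDEC x (ftop L) (flaw L)` (`sdec_siblings_of_reducible`).  So `SiblingStep` owes only forests all of whose siblings are
MEAN-HEAVY. [this work] -/
theorem sdec_siblings_of_meanLight {x : ℝ} (hx0 : 0 < x) (L : List Sib) (hL : ∀ s ∈ L, s.TreeOK x)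
    (hO : ∀ (x' : ℝ) (n' M' : ℕ) (μ' : ℕ → ℝ), n' < fgates L → TreeBuiltN x' n' M' μ' → SDEC x' M' μ')
    (hex : ∃ s ∈ L, s.q * s.mean ≤ 1) : SDEC x (ftop L) (flaw L) := by
  obtain ⟨s, hs, hlight⟩ := hex
  exact sdec_siblings_of_reducible hx0 L hL hO ⟨s, hs, _, inBlobHull_gate_of_meanLight_treeOK s (hL s hs) hlight⟩

end LawDec
end Quant
end Summit.CriticalPhenomena.PercolationContinuityZ3.Theorems
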